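import Literature.Analysis.FluidPDE.TypeIAncientMild
import Literature.Analysis.FluidPDE.CZeroSolenoidalPeriodOperators
import Literature.Analysis.FluidPDE.SolenoidalCZeroTestFields
import Literature.Analysis.FluidPDE.RdssPeriodConcatenation
import Mathlib.Analysis.Calculus.FDeriv.Comp
import Summits.NavierStokesRegularity.NavierStokesRegularity.Theorems.FilamentSkeletonRssRdssProfileTruncation
import Summits.NavierStokesRegularity.NavierStokesRegularity.Theorems.DssFarFieldSlavingDssTruncationBridge
import Summits.NavierStokesRegularity.NavierStokesRegularity.Theorems.PumpContinuationEulerProximatePumpTypeIConcatenation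
import Summits.NavierStokesRegularity.NavierStokesRegularity.Theses.PumpContinuation
import HarnessLib

/-!
# Route `PumpContinuation`, crux `EulerProximatePump` (stmt-NavierStokesRegularity-18302), line
  `SketchIdeator2` — stub `stub_dssTruncationBridgeTypeI` (= item stmt-NavierStokesRegularity-14478,
  `DssFarFieldSlaving.DssTruncationBridgeTypeI`), PROVED

`DssTruncationBridgeTypeI`: if Tsai's Type-I (rotated) `λ`-DSS Liouville wall fails,
`¬ (∀ c, TypeIDSSLiouville c ∧ ∀ R, RotatedTypeIDSSLiouville c R)`, then for some `ν > 0`, `T > 0`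
there is a Leray–Hopf classical solution of Navier–Stokes from a rapidly decaying datum with finite
maximal lifespan `T` **which blows up at the Type-I rate** (`IsMaximalSmoothSolution ν 0 u p T ∧
IsLerayHopfOn T ν 0 (u 0) u ∧ HasRapidSpatialDecay (u 0) ∧ IsTypeIBlowup u T`).

## Proof

The rate-free bridge `DssTruncationBridge` (stmt-14477) is in tree
(`Theorems/DssFarFieldSlavingDssTruncationBridge.lean`): the negated wall supplies a nontrivial
Type-I rotated-DSS ancient mild solution (`exists_typeI_rdss_ancient_of_not_liouville`), and the
sibling crux `RdssProfileTruncation` (stmt-11289, `filamentSkeletonRss_rdssProfileTruncation_proof`,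
line "subcritical quasi-compact steering") truncates it to a compactly supported solenoidal datum whose
Leray–Hopf classical solution has maximal lifespan `1`.  That construction already CARRIES the Type-I
rate, it only does not record it: along the trapped orbit `g_k = Tᵏ g` of the period map
(`‖g_k‖ < η₀` for all `k`) the model solutions `u + Φ g_k` on the period `[−1, −c⁻²]` are bounded by
`C/√(c⁻²) + Λ‖g_k‖ ≤ C·c + Λ η₀ =: M₀` UNIFORMLY in `k` (`|u| ≤ C/√(−t)` is the Type-I bound of the
profile, `‖Φ g‖ ≤ Λ‖g‖` the Lipschitz bound of the slab flow), and the physical solution is the zoom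
`v(t, x) = cᵏ (Rᵏ)⁻¹ (u + Φ g_k)(c^{2k}(t − 1), cᵏ Rᵏ x)` on `t ∈ [1 − c^{−2k}, 1 − c^{−2k−2}]`, where
`cᵏ ≤ (1 − t)^{−1/2}`; hence `‖v(t, x)‖ ≤ M₀ / √(1 − t)` on `[0, 1)`.  Both tree lemmas hide `v`
behind an existential, so this file re-proves the period package with the Type-I conclusion added
(`rdssPeriodPackage_typeI`, same hypotheses as the tree's `stub_rdssPeriodPackage`, same proof, fed
with the Type-I concatenation `exists_concatenation_of_periodic_slabs_typeI` of
`Theorems/PumpContinuationEulerProximatePumpTypeIConcatenation.lean`), re-runs the assembly with the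
rate carried through the Oseen-classical and final-slice repackagings (`w' = w = v` on `[0, 1)`;
`rdssProfileTruncation_typeI`), and composes with `exists_typeI_rdss_ancient_of_not_liouville`
(`dssTruncationBridgeTypeI_proof`).  The file closes with the registered stub
`PumpContinuationEulerProximatePump.stub_dssTruncationBridgeTypeI` of the line's skeleton
(`Cruxes/EulerProximatePump/Lines/SketchIdeator2.lean`): its composition `EulerProximatePump_of` is
thereby closed modulo the single conjecture-grade stub `stub_blowupTypeIDssProfile` = item
stmt-NavierStokesRegularity-0155 = `¬`(Tsai's Type-I RDSS Liouville conjecture).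

## References

* G. Koch, N. Nadirashvili, G. Seregin, V. Šverák, Acta Math. 203 (2009), §1 (1.2) (the Type-I bound
  and its scaling), §4. [KochNadirashviliSereginSverak2009]
* Z. Bradshaw, T.-P. Tsai, Comm. PDE 42 (2017) = arXiv:1610.05680, §1, §5 Open Problem 5.1 (RDSS
  fields, period map modulo rotation; the Type-I RDSS Liouville problem). [BradshawTsai2017CPDE]
-/

noncomputable section

open MeasureTheory Set Function Filter
open _root_.Topology
open scoped RealInnerProductSpace ContDiff

set_option linter.dupNamespace false

namespace Summit.NavierStokesRegularity.NavierStokesRegularity.Theorems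

namespace PumpContinuationEulerProximatePump

open Literature.Analysis Literature.Analysis.FluidPDE

/-- **The period-map package with the Type-I rate** (functional-analytic packaging of the period
map and the physical semantics of a trapped orbit; verbatim the tree's `stub_rdssPeriodPackage` of
`Theorems/FilamentSkeletonRssRdssProfileTruncationPeriodPackage.lean` with ONE conclusion added).
GIVEN the one-period flow package of `stub_rdssSlabFlow` (as a hypothesis), build: the Banach space
`E` (continuous weakly divergence-free fields vanishing at infinity, sup norm), the dense submodule `D`
of smooth compactly supported divergence-free fields, the zoom-out `𝒮⁻¹ g = c⁻¹ R g(c⁻¹ R⁻¹ ·)`, the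
recentred period map `T g = 𝒮⁻¹ (Φ g (−c⁻²))` with strict derivative `M = S + K`,
`S = 𝒮⁻¹ ∘ e^{(1−c⁻²)Δ}` (`‖Sⁿ‖ ≤ c⁻ⁿ`), `K = 𝒮⁻¹ ∘ Klin` compact, the truncation data, and the
SEMANTICS of an orbit `g_k = Tᵏ g` in the `η₀`-ball: the concatenation of the zoomed model solutions
`u + Φ g_k` is an Oseen-mild solution on `[0, 1)` from `u(−1) + g`, continuous, weakly divergence
free, bounded on every `[0, 1−δ]`, unbounded at `(1, 0)`, and — NEW — **Type I**:
`‖v(t, x)‖ ≤ M₀ / √(1 − t)` on `[0, 1)` with `M₀ = C/√(c⁻²) + Λ η₀`, because the model slabs are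
bounded by `M₀` uniformly in `k` along the trapped orbit and `cᵏ ≤ (1 − t)^{−1/2}` on the `k`-th
physical slab (`exists_concatenation_of_periodic_slabs_typeI`).
[cite: BradshawTsai2017CPDE, §1 (RDSS, period map modulo rotation); KochNadirashviliSereginSverak2009, §4] -/
theorem rdssPeriodPackage_typeI :
    ∀ (C C₀ c : ℝ) (R : EuclideanSpace ℝ (Fin 3) ≃ₗᵢ[ℝ] EuclideanSpace ℝ (Fin 3)) (u : ℝ → EuclideanSpace ℝ (Fin 3) → EuclideanSpace ℝ (Fin 3)) (y₀ : EuclideanSpace ℝ (Fin 3)),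
      IsTypeIAncientMild C u → IsRotatedDSS c R u → 1 < c → HasTypeIDecay C₀ u → u (-1) y₀ ≠ 0 →
      (∃ δ₀ : ℝ, 0 < δ₀ ∧ ∃ Λ : ℝ, 0 ≤ Λ ∧
        ∃ (Φ : (EuclideanSpace ℝ (Fin 3) → EuclideanSpace ℝ (Fin 3)) → ℝ → EuclideanSpace ℝ (Fin 3) → EuclideanSpace ℝ (Fin 3)) (Klin : (EuclideanSpace ℝ (Fin 3) → EuclideanSpace ℝ (Fin 3)) → EuclideanSpace ℝ (Fin 3) → EuclideanSpace ℝ (Fin 3)),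
        (∀ t x, Φ 0 t x = 0) ∧
        (∀ g : EuclideanSpace ℝ (Fin 3) → EuclideanSpace ℝ (Fin 3), Continuous g → Tendsto g (cocompact (EuclideanSpace ℝ (Fin 3))) (𝓝 0) → IsWeaklyDivFree g →
          ∀ B : ℝ, (∀ x, ‖g x‖ ≤ B) → B < δ₀ →
            Φ g (-1) = g ∧
            ContinuousOn (uncurry (Φ g)) (Icc (-1) (-(c ^ 2)⁻¹) ×ˢ univ) ∧
            (∀ t ∈ Icc (-1 : ℝ) (-(c ^ 2)⁻¹), Tendsto (Φ g t) (cocompact (EuclideanSpace ℝ (Fin 3))) (𝓝 0) ∧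
              IsWeaklyDivFree (Φ g t) ∧ ∀ x, ‖Φ g t x‖ ≤ Λ * B) ∧
            (∀ s t : ℝ, -1 ≤ s → s < t → t ≤ -(c ^ 2)⁻¹ → ∀ x,
              (u + Φ g) t x = heatFlow ((u + Φ g) s) (t - s) x -
                oseenDuhamel 1 s (u + Φ g) (u + Φ g) t x)) ∧
        (∀ g₁ g₂ : EuclideanSpace ℝ (Fin 3) → EuclideanSpace ℝ (Fin 3), Continuous g₁ → Tendsto g₁ (cocompact (EuclideanSpace ℝ (Fin 3))) (𝓝 0) → IsWeaklyDivFree g₁ →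
          Continuous g₂ → Tendsto g₂ (cocompact (EuclideanSpace ℝ (Fin 3))) (𝓝 0) → IsWeaklyDivFree g₂ →
          ∀ B Bd : ℝ, (∀ x, ‖g₁ x‖ ≤ B) → (∀ x, ‖g₂ x‖ ≤ B) → B < δ₀ → (∀ x, ‖g₁ x - g₂ x‖ ≤ Bd) →
            ∀ t ∈ Icc (-1 : ℝ) (-(c ^ 2)⁻¹), ∀ x, ‖Φ g₁ t x - Φ g₂ t x‖ ≤ Λ * Bd) ∧
        (∀ h₁ h₂ : EuclideanSpace ℝ (Fin 3) → EuclideanSpace ℝ (Fin 3), Continuous h₁ → Tendsto h₁ (cocompact (EuclideanSpace ℝ (Fin 3))) (𝓝 0) → IsWeaklyDivFree h₁ →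
          Continuous h₂ → Tendsto h₂ (cocompact (EuclideanSpace ℝ (Fin 3))) (𝓝 0) → IsWeaklyDivFree h₂ → ∀ r : ℝ,
            Klin (h₁ + h₂) = Klin h₁ + Klin h₂ ∧ Klin (r • h₁) = r • Klin h₁) ∧
        (∀ h : EuclideanSpace ℝ (Fin 3) → EuclideanSpace ℝ (Fin 3), Continuous h → Tendsto h (cocompact (EuclideanSpace ℝ (Fin 3))) (𝓝 0) → IsWeaklyDivFree h →
          ∀ B : ℝ, (∀ x, ‖h x‖ ≤ B) →
            Continuous (Klin h) ∧ Tendsto (Klin h) (cocompact (EuclideanSpace ℝ (Fin 3))) (𝓝 0) ∧ IsWeaklyDivFree (Klin h) ∧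
              ∀ x, ‖Klin h x‖ ≤ Λ * B) ∧
        (∀ ε : ℝ, 0 < ε → ∃ A : ℝ, ∀ h : EuclideanSpace ℝ (Fin 3) → EuclideanSpace ℝ (Fin 3), Continuous h → Tendsto h (cocompact (EuclideanSpace ℝ (Fin 3))) (𝓝 0) →
          IsWeaklyDivFree h → (∀ x, ‖h x‖ ≤ 1) → ∀ x, A ≤ ‖x‖ → ‖Klin h x‖ ≤ ε) ∧
        (∀ ε : ℝ, 0 < ε → ∃ δ : ℝ, 0 < δ ∧ ∀ h : EuclideanSpace ℝ (Fin 3) → EuclideanSpace ℝ (Fin 3), Continuous h → Tendsto h (cocompact (EuclideanSpace ℝ (Fin 3))) (𝓝 0) →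
          IsWeaklyDivFree h → (∀ x, ‖h x‖ ≤ 1) → ∀ x y, dist x y < δ → ‖Klin h x - Klin h y‖ ≤ ε) ∧
        (∀ ε : ℝ, 0 < ε → ∃ δ : ℝ, 0 < δ ∧ ∀ g₁ g₂ : EuclideanSpace ℝ (Fin 3) → EuclideanSpace ℝ (Fin 3),
          Continuous g₁ → Tendsto g₁ (cocompact (EuclideanSpace ℝ (Fin 3))) (𝓝 0) → IsWeaklyDivFree g₁ →
          Continuous g₂ → Tendsto g₂ (cocompact (EuclideanSpace ℝ (Fin 3))) (𝓝 0) → IsWeaklyDivFree g₂ →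
          ∀ B Bd : ℝ, (∀ x, ‖g₁ x‖ ≤ B) → (∀ x, ‖g₂ x‖ ≤ B) → B < δ → (∀ x, ‖g₁ x - g₂ x‖ ≤ Bd) →
            ∀ x, ‖(Φ g₁ (-(c ^ 2)⁻¹) x - Φ g₂ (-(c ^ 2)⁻¹) x) -
              (heatFlow (g₁ - g₂) (1 - (c ^ 2)⁻¹) x + Klin (g₁ - g₂) x)‖ ≤ ε * Bd)) →
      ∃ (E : Type) (_ : NormedAddCommGroup E) (_ : NormedSpace ℝ E) (_ : CompleteSpace E)
        (ι : E →ₗ[ℝ] (EuclideanSpace ℝ (Fin 3) → EuclideanSpace ℝ (Fin 3))) (D : Submodule ℝ E) (T : E → E) (M S K : E →L[ℝ] E),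
        Dense (D : Set E) ∧
        (∀ d ∈ D, ContDiff ℝ ∞ (ι d) ∧ HasCompactSupport (ι d) ∧ VectorCalculus.IsDivFree (ι d)) ∧
        M = S + K ∧ IsCompactOperator K ∧
        (∃ Cs θ₀ : ℝ, 0 ≤ θ₀ ∧ θ₀ < 1 ∧ ∀ n : ℕ, ‖S ^ n‖ ≤ Cs * θ₀ ^ n) ∧
        T 0 = 0 ∧ HasStrictFDerivAt T M 0 ∧
        (∀ ε : ℝ, 0 < ε → ∃ e : E, ‖e‖ < ε ∧ ContDiff ℝ ∞ (u (-1) + ι e) ∧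
          HasCompactSupport (u (-1) + ι e) ∧ VectorCalculus.IsDivFree (u (-1) + ι e)) ∧
        ∃ η₀ : ℝ, 0 < η₀ ∧ ∀ g : E, (∀ k : ℕ, ‖T^[k] g‖ < η₀) →
          ∃ v : ℝ → EuclideanSpace ℝ (Fin 3) → EuclideanSpace ℝ (Fin 3), v 0 = u (-1) + ι g ∧
            ContinuousOn (uncurry v) (Ico 0 1 ×ˢ univ) ∧
            (∀ t ∈ Ico (0 : ℝ) 1, IsWeaklyDivFree (v t)) ∧
            (∀ s t : ℝ, 0 ≤ s → s < t → t < 1 → ∀ x,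
              v t x = heatFlow (v s) (t - s) x - oseenDuhamel 1 s v v t x) ∧
            (∀ δ : ℝ, 0 < δ → IsBoundedOn (Icc 0 (1 - δ)) v) ∧
            (∀ K δ : ℝ, 0 < δ → ∃ t ∈ Ico (0 : ℝ) 1, ∃ x : EuclideanSpace ℝ (Fin 3), 1 - δ < t ∧ ‖x‖ < δ ∧ K < ‖v t x‖) ∧
            (∃ M₀ : ℝ, ∀ t ∈ Ico (0 : ℝ) 1, ∀ x, ‖v t x‖ ≤ M₀ / Real.sqrt (1 - t)) := by
  intro C C₀ c R u y₀ hK hrdss hc hdec hy₀ hpkg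
  obtain ⟨δ₀, hδ₀, Λ, hΛ, Φ, Klin, hΦ0, hsol, -, hKlin_lin, hKlin_map, hKlin_tail, hKlin_equi,
    hder⟩ := hpkg
  -- constants
  have hc0 : 0 < c := one_pos.trans hc
  have hc2 : 0 < c ^ 2 := by positivity
  have hq0 : 0 < (c ^ 2)⁻¹ := inv_pos.2 hc2
  have hq1 : (c ^ 2)⁻¹ < 1 := inv_lt_one_of_one_lt₀ (by nlinarith)
  have hτ : 0 < 1 - (c ^ 2)⁻¹ := sub_pos.2 hq1
  have hqneg : -(c ^ 2)⁻¹ < 0 := neg_neg_of_pos hq0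
  have hE3 : Module.finrank ℝ (EuclideanSpace ℝ (Fin 3)) = 3 := finrank_euclideanSpace_fin
  have hCnn : 0 ≤ C := hK.nonneg
  -- the Banach space `F = C₀,σ`
  obtain ⟨F, hFc, hF⟩ := exists_isClosed_submodule_czero_solenoidal (E := EuclideanSpace ℝ (Fin 3))
  haveI : CompleteSpace F := hFc.completeSpace_coe
  have hPf : ∀ f : F, Continuous ⇑f.1 ∧ Tendsto ⇑f.1 (cocompact (EuclideanSpace ℝ (Fin 3))) (𝓝 0) ∧
      IsWeaklyDivFree ⇑f.1 := fun f => (hF f.1).1 f.2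
  have hbd : ∀ f : F, ∀ x, ‖f.1 x‖ ≤ ‖f‖ := fun f =>
    FunctionSpaces.norm_apply_le_norm_submodule F f
  let ι : F →ₗ[ℝ] (EuclideanSpace ℝ (Fin 3) → EuclideanSpace ℝ (Fin 3)) :=
    { toFun := fun f => ⇑f.1
      map_add' := fun f g => by funext x; simp
      map_smul' := fun r f => by funext x; simp }
  -- the bounded operators: zoom-out, heat, compact linear part
  obtain ⟨Z, hZ, hZn⟩ := exists_zoom_clm F hF (inv_pos.2 hc0) R
  obtain ⟨H, hH, hHn⟩ := exists_heat_clm F hF hτ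
  obtain ⟨KE, hKE, -, hKEc⟩ :=
    exists_compact_clm_of_pointwise F hFc hF Klin hΛ hKlin_lin hKlin_map hKlin_tail hKlin_equi
  -- the final slice of the slab flow as a self-map with strict derivative `H + KE`
  have hmemI : (-(c ^ 2)⁻¹ : ℝ) ∈ Icc (-1 : ℝ) (-(c ^ 2)⁻¹) := ⟨by linarith, le_rfl⟩
  have hsol1 : ∀ g : EuclideanSpace ℝ (Fin 3) → EuclideanSpace ℝ (Fin 3), Continuous g → Tendsto g (cocompact (EuclideanSpace ℝ (Fin 3))) (𝓝 0) →
      IsWeaklyDivFree g → ∀ B : ℝ, (∀ x, ‖g x‖ ≤ B) → B < δ₀ →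
        Continuous (Φ g (-(c ^ 2)⁻¹)) ∧ Tendsto (Φ g (-(c ^ 2)⁻¹)) (cocompact (EuclideanSpace ℝ (Fin 3))) (𝓝 0) ∧
          IsWeaklyDivFree (Φ g (-(c ^ 2)⁻¹)) ∧ ∀ x, ‖Φ g (-(c ^ 2)⁻¹) x‖ ≤ Λ * B := by
    intro g hg hg0 hgd B hB hBδ
    obtain ⟨-, hcont, hslice, -⟩ := hsol g hg hg0 hgd B hB hBδ
    obtain ⟨h0, hd, hb⟩ := hslice _ hmemI
    exact ⟨hcont.comp_continuous (continuous_const.prodMk continuous_id)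
      fun x => ⟨hmemI, mem_univ x⟩, h0, hd, hb⟩
  obtain ⟨P, hPin, -, hP0, hPder⟩ := exists_selfMap_hasStrictFDerivAt_zero F hF
    (fun g => Φ g (-(c ^ 2)⁻¹)) Klin hδ₀ hτ (fun x => hΦ0 _ x) hsol1 hder H KE hH hKE
  -- the period map and its derivative
  let T : F → F := fun g => Z (P g)
  let S : F →L[ℝ] F := Z.comp H
  let K : F →L[ℝ] F := Z.comp KE
  have hT0 : T 0 = 0 := by simp [T, hP0]
  have hTder : HasStrictFDerivAt T (S + K) 0 := by
    have h1 : HasStrictFDerivAt (fun g => Z (P g)) (Z.comp (H + KE)) 0 :=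
      Z.hasStrictFDerivAt.comp 0 hPder
    rwa [ContinuousLinearMap.comp_add] at h1
  have hKc : IsCompactOperator K := hKEc.clm_comp Z
  have hSn : ∀ n : ℕ, ‖S ^ n‖ ≤ 1 * c⁻¹ ^ n := by
    refine norm_pow_le_one_mul_pow S ?_
    calc ‖Z.comp H‖ ≤ ‖Z‖ * ‖H‖ := Z.opNorm_comp_le H
      _ ≤ c⁻¹ * 1 :=
          mul_le_mul hZn hHn (ContinuousLinearMap.opNorm_nonneg H) (inv_nonneg.2 hc0.le)
      _ = c⁻¹ := mul_one _
  -- dense directions and truncation data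
  obtain ⟨D, hDdense, hDmem⟩ := exists_dense_submodule_testFields hE3 F hF
  have hdecU : ∀ y : EuclideanSpace ℝ (Fin 3), ‖y‖ * ‖u (-1) y‖ ≤ C₀ := by
    intro y
    have h1 := hdec (-1) (by norm_num) y
    rw [neg_neg, Real.sqrt_one] at h1
    have hC₀ : 0 ≤ C₀ := by
      have h0 := hdec (-1) (by norm_num) 0
      rw [neg_neg, Real.sqrt_one, norm_zero, zero_add, div_one] at h0
      exact (norm_nonneg _).trans h0
    have hpos : 0 < ‖y‖ + 1 := by positivity
    calc ‖y‖ * ‖u (-1) y‖ ≤ ‖y‖ * (C₀ / (‖y‖ + 1)) := by gcongr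
      _ = C₀ * (‖y‖ / (‖y‖ + 1)) := by ring
      _ ≤ C₀ * 1 := by
          gcongr
          rw [div_le_one hpos]; linarith
      _ = C₀ := mul_one _
  -- the orbit radius
  set η₀ : ℝ := min (δ₀ / 2) (‖u (-1) y₀‖ / 2) with hη₀
  have hUy₀ : 0 < ‖u (-1) y₀‖ := norm_pos_iff.2 hy₀
  have hη₀pos : 0 < η₀ := lt_min (half_pos hδ₀) (half_pos hUy₀)
  refine ⟨F, inferInstance, inferInstance, inferInstance, ι, D, T, S + K, S, K, hDdense,
    fun d hd => hDmem d hd, rfl, hKc, ⟨1, c⁻¹, inv_nonneg.2 hc0.le, inv_lt_one_of_one_lt₀ hc, hSn⟩,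
    hT0, hTder, fun ε hε => ?_, η₀, hη₀pos, fun g hg => ?_⟩
  · -- truncation data
    obtain ⟨e, he, hs, hcs, hdiv⟩ := exists_small_solenoidal_truncation_datum hE3 F hF
      (hK.contDiff_slice (by norm_num)) (hK.isDivFree (by norm_num)) hdecU hε
    exact ⟨e, he, hs, hcs, hdiv⟩
  · -- semantics of a trapped orbit
    have hgk : ∀ k, ‖T^[k] g‖ < δ₀ := fun k =>
      (hg k).trans_le ((min_le_left _ _).trans (half_le_self hδ₀.le))
    have hsolk : ∀ k, Φ (⇑(T^[k] g).1) (-1) = ⇑(T^[k] g).1 ∧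
        ContinuousOn (uncurry (Φ ⇑(T^[k] g).1)) (Icc (-1) (-(c ^ 2)⁻¹) ×ˢ univ) ∧
        (∀ t ∈ Icc (-1 : ℝ) (-(c ^ 2)⁻¹), Tendsto (Φ (⇑(T^[k] g).1) t) (cocompact (EuclideanSpace ℝ (Fin 3))) (𝓝 0) ∧
          IsWeaklyDivFree (Φ (⇑(T^[k] g).1) t) ∧ ∀ x, ‖Φ (⇑(T^[k] g).1) t x‖ ≤ Λ * ‖T^[k] g‖) ∧
        (∀ s t : ℝ, -1 ≤ s → s < t → t ≤ -(c ^ 2)⁻¹ → ∀ x,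
          (u + Φ ⇑(T^[k] g).1) t x = heatFlow ((u + Φ ⇑(T^[k] g).1) s) (t - s) x -
            oseenDuhamel 1 s (u + Φ ⇑(T^[k] g).1) (u + Φ ⇑(T^[k] g).1) t x) := fun k =>
      hsol _ (hPf _).1 (hPf _).2.1 (hPf _).2.2 _ (hbd _) (hgk k)
    have hIcc : ∀ t ∈ Icc (-1 : ℝ) (-(c ^ 2)⁻¹), t < 0 := fun t ht => lt_of_le_of_lt ht.2 hqneg
    have hu_cont : ContinuousOn (uncurry u) (Icc (-1) (-(c ^ 2)⁻¹) ×ˢ univ) :=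
      hK.continuousOn_uncurry.mono (prod_mono (fun t ht => hIcc t ht) subset_rfl)
    -- bounds on the model slab, UNIFORM along the trapped orbit (`‖g_k‖ < η₀`)
    have hbdU : ∀ k, ∀ t ∈ Icc (-1 : ℝ) (-(c ^ 2)⁻¹), ∀ x,
        ‖(u + Φ ⇑(T^[k] g).1) t x‖ ≤ C / Real.sqrt ((c ^ 2)⁻¹) + Λ * η₀ := by
      intro k t ht x
      have ht0 : t < 0 := hIcc t ht
      have h1 : ‖u t x‖ ≤ C / Real.sqrt ((c ^ 2)⁻¹) := by
        refine (hK.norm_le ht0 x).trans ?_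
        exact div_le_div_of_nonneg_left hCnn (Real.sqrt_pos.2 hq0)
          (Real.sqrt_le_sqrt (by linarith [ht.2]))
      have h2 : ‖Φ (⇑(T^[k] g).1) t x‖ ≤ Λ * ‖T^[k] g‖ := ((hsolk k).2.2.1 t ht).2.2 x
      have h3 : Λ * ‖T^[k] g‖ ≤ Λ * η₀ := mul_le_mul_of_nonneg_left (hg k).le hΛ
      calc ‖(u + Φ ⇑(T^[k] g).1) t x‖ = ‖u t x + Φ (⇑(T^[k] g).1) t x‖ := rfl
        _ ≤ ‖u t x‖ + ‖Φ (⇑(T^[k] g).1) t x‖ := norm_add_le _ _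
        _ ≤ _ := add_le_add h1 (h2.trans h3)
    -- weakly divergence-free slices
    have hdiv' : ∀ k, ∀ t ∈ Icc (-1 : ℝ) (-(c ^ 2)⁻¹), IsWeaklyDivFree ((u + Φ ⇑(T^[k] g).1) t) := by
      intro k t ht
      have ht0 : t < 0 := hIcc t ht
      have hΦc : Continuous (Φ (⇑(T^[k] g).1) t) :=
        (hsolk k).2.1.comp_continuous (continuous_const.prodMk continuous_id)
          fun x => ⟨ht, mem_univ x⟩
      exact (hK.isWeaklyDivFree ht0).add_of_continuous ((hsolk k).2.2.1 t ht).2.1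
        (hK.continuous_slice ht0) hΦc
    -- the junction condition: `(u + Φ g_{k+1})(-1) = 𝒮⁻¹((u + Φ g_k)(-c⁻²))`
    have hjump' : ∀ k y, (u + Φ ⇑(T^[k + 1] g).1) (-1) y =
        c⁻¹ • R ((u + Φ ⇑(T^[k] g).1) (-(c ^ 2)⁻¹) (c⁻¹ • R.symm y)) := by
      intro k y
      have hk1 := (hsolk (k + 1)).1
      have hiter : T^[k + 1] g = T (T^[k] g) := Function.iterate_succ_apply' T k g
      have hTval : (⇑(T (T^[k] g)).1 : EuclideanSpace ℝ (Fin 3) → EuclideanSpace ℝ (Fin 3)) y =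
          c⁻¹ • R (Φ (⇑(T^[k] g).1) (-(c ^ 2)⁻¹) (c⁻¹ • R.symm y)) := by
        show (Z (P (T^[k] g))).1 y = _
        rw [hZ, hPin _ (hgk k)]
      calc (u + Φ ⇑(T^[k + 1] g).1) (-1) y = u (-1) y + Φ (⇑(T^[k + 1] g).1) (-1) y := rfl
        _ = u (-1) y + (⇑(T^[k + 1] g).1 : EuclideanSpace ℝ (Fin 3) → EuclideanSpace ℝ (Fin 3)) y := by rw [hk1]
        _ = c⁻¹ • R (u (-(c ^ 2)⁻¹) (c⁻¹ • R.symm y)) +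
              c⁻¹ • R (Φ (⇑(T^[k] g).1) (-(c ^ 2)⁻¹) (c⁻¹ • R.symm y)) := by
            rw [rdss_slice_neg_one hc0 hrdss y, hiter, hTval]
        _ = c⁻¹ • R ((u + Φ ⇑(T^[k] g).1) (-(c ^ 2)⁻¹) (c⁻¹ • R.symm y)) := by
            rw [← smul_add, ← map_add]
            rfl
    -- the orbit stays away from `-u(-1, y₀)`
    have hmk' : ∀ k, ‖u (-1) y₀‖ / 2 ≤ ‖(u + Φ ⇑(T^[k] g).1) (-1) y₀‖ := by
      intro k
      have hk1 := (hsolk k).1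
      have hgy : ‖(⇑(T^[k] g).1 : EuclideanSpace ℝ (Fin 3) → EuclideanSpace ℝ (Fin 3)) y₀‖ ≤ ‖u (-1) y₀‖ / 2 :=
        ((hbd _ y₀).trans (hg k).le).trans (min_le_right _ _)
      have e : (u + Φ ⇑(T^[k] g).1) (-1) y₀ = u (-1) y₀ + (⇑(T^[k] g).1 : EuclideanSpace ℝ (Fin 3) → EuclideanSpace ℝ (Fin 3)) y₀ := by
        show u (-1) y₀ + Φ (⇑(T^[k] g).1) (-1) y₀ = _
        rw [hk1]
      rw [e]
      have h := norm_sub_le (u (-1) y₀ + (⇑(T^[k] g).1 : EuclideanSpace ℝ (Fin 3) → EuclideanSpace ℝ (Fin 3)) y₀) ((⇑(T^[k] g).1 : EuclideanSpace ℝ (Fin 3) → EuclideanSpace ℝ (Fin 3)) y₀)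
      rw [add_sub_cancel_right] at h
      linarith
    obtain ⟨v, hv0, hvc, hvd, hvo, hvb, hvu, hvI⟩ := exists_concatenation_of_periodic_slabs_typeI hc R
      (fun k => u + Φ ⇑(T^[k] g).1) (fun k => hu_cont.add (hsolk k).2.1) _ hbdU hdiv'
      (fun k => (hsolk k).2.2.2) hjump' y₀ (half_pos hUy₀) hmk'
    refine ⟨v, ?_, hvc, hvd, hvo, hvb, hvu, _, hvI⟩
    rw [hv0]
    funext x
    have h0 := (hsolk 0).1
    simp only [Function.iterate_zero, id_eq] at h0
    simp only [Function.iterate_zero, id_eq, Pi.add_apply, h0]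
    rfl

end PumpContinuationEulerProximatePump

/-! ## The truncation bridge with the Type-I rate -/

open Literature.Analysis Literature.Analysis.FluidPDE PumpContinuationEulerProximatePump

/-- **`RdssProfileTruncation` with the Type-I rate**: a nontrivial Type-I rotated-DSS ancient mild
solution (`ν = 1`, factor `c > 1`, isometry `R`) yields a compactly supported smooth solenoidal datum
whose Leray–Hopf classical solution has finite maximal lifespan `T = 1` AND blows up at the Type-I
rate, `‖u(t, x)‖ ≤ C/√(1 − t)` near `t = 1`.  Same subcritical quasi-compact steering as the tree's
`filamentSkeletonRss_rdssProfileTruncation_proof`, run with the Type-I period package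
`rdssPeriodPackage_typeI`; the classical / final-slice representatives agree with `v` on `[0, 1)`, so
the rate `‖v(t, x)‖ ≤ M₀/√(1 − t)` passes to them. [cite: KochNadirashviliSereginSverak2009, §4; HirschPughShub1977, Thm 5.1] -/
theorem rdssProfileTruncation_typeI
    (h : ∃ (c : ℝ) (R : EuclideanSpace ℝ (Fin 3) ≃ₗᵢ[ℝ] EuclideanSpace ℝ (Fin 3)) (u : ℝ → EuclideanSpace ℝ (Fin 3) → EuclideanSpace ℝ (Fin 3)),
      1 < c ∧ IsAncientMildSolution 1 u ∧ (∀ t < 0, AEStronglyMeasurable (u t) volume) ∧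
      IsRotatedDSS c R u ∧ (∃ C₀ : ℝ, HasTypeIDecay C₀ u) ∧ ¬ (∀ t < 0, u t =ᵐ[volume] 0)) :
    ∃ ν : ℝ, 0 < ν ∧ ∃ T : ℝ, 0 < T ∧ ∃ (u : ℝ → EuclideanSpace ℝ (Fin 3) → EuclideanSpace ℝ (Fin 3)) (p : ℝ → EuclideanSpace ℝ (Fin 3) → ℝ),
      IsMaximalSmoothSolution ν 0 u p T ∧ IsLerayHopfOn T ν 0 (u 0) u ∧
      HasRapidSpatialDecay (u 0) ∧ IsTypeIBlowup u T := by
  obtain ⟨c, R, u, hc, hmild, hmeas, hrdss, hTypeI, hnz⟩ := h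
  obtain ⟨u₁, C, C₀, t₀, x₀, hK₁, hrdss₁, hdec₁, ht₀, hx₀⟩ :=
    stub_rdssSmoothRepresentative c R u hc hmild hmeas hrdss hTypeI hnz
  obtain ⟨u₂, y₀, hK₂, hrdss₂, hdec₂, hy₀⟩ :=
    stub_rdssRescale C C₀ c t₀ R u₁ x₀ hK₁ hrdss₁ hdec₁ ht₀ hx₀
  -- the period-map package, with the Type-I semantics
  obtain ⟨E, _, _, _, ι, D, T, M, S, K, hD, hDnice, hMSK, hKc, ⟨Cs, θ₀, hθ₀, hθ₁, hS⟩, hT0, hTd,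
    htrunc, η₀, hη₀, hsem⟩ := rdssPeriodPackage_typeI C C₀ c R u₂ y₀ hK₂ hrdss₂ hc hdec₂ hy₀
      (stub_rdssSlabFlow C C₀ c R u₂ hK₂ hrdss₂ hc hdec₂)
  obtain ⟨r, hr, hsteer⟩ := stub_pseudoStableSteering E T M S K D Cs θ₀ hMSK hKc hθ₀ hθ₁ hS hT0 hTd hD η₀ hη₀
  obtain ⟨e, he, hsm_e, hcs_e, hdiv_e⟩ := htrunc r hr
  obtain ⟨d, hd, horbit⟩ := hsteer e he
  obtain ⟨hsm_d, hcs_d, hdiv_d⟩ := hDnice d hd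
  -- the physical solution on [0, 1), Type I
  obtain ⟨v, hv0, hvcont, hvdiv, hvoseen, hvbdd, hvunb, M₀, hvI⟩ := hsem (e + d) horbit
  have hdat : v 0 = (u₂ (-1) + ι e) + ι d := by rw [hv0, map_add, add_assoc]
  have hsm : ContDiff ℝ ∞ (v 0) := by rw [hdat]; exact hsm_e.add hsm_d
  have hcs : HasCompactSupport (v 0) := by rw [hdat]; exact hcs_e.add hcs_d
  have hdiv : VectorCalculus.IsDivFree (v 0) := by
    rw [hdat]
    intro x
    have h1 := hdiv_e x
    have h2 := hdiv_d x
    simp only [VectorCalculus.divergence] at h1 h2 ⊢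
    rw [fderiv_add ((hsm_e.differentiable (by simp)).differentiableAt)
      ((hsm_d.differentiable (by simp)).differentiableAt)]
    simp [map_add, h1, h2]
  -- classical + Leray–Hopf packaging
  obtain ⟨w, q, hwv, hwcl, hwLH⟩ :=
    stub_oseenClassicalPackage 1 v one_pos hsm hcs hdiv hvcont hvdiv hvoseen hvbdd
  obtain ⟨w', hw'w, hLH⟩ := stub_lerayHopfFinalSlice 1 1 (v 0) w one_pos one_pos hwLH
  have hcl' : IsClassicalNSSolutionOn (Ico 0 1) 1 0 w' q := isClassicalNSSolutionOn_Ico_congr hwcl hw'w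
  have h0 : (0 : ℝ) ∈ Ico (0 : ℝ) 1 := ⟨le_rfl, one_pos⟩
  have hw'0 : w' 0 = v 0 := by rw [hw'w 0 h0, hwv 0 h0]
  -- maximality from unboundedness at (1, 0)
  have hunb' : ∀ K δ : ℝ, 0 < δ → ∃ t ∈ Ico (0 : ℝ) 1, ∃ x : EuclideanSpace ℝ (Fin 3), 1 - δ < t ∧ ‖x‖ < δ ∧ K < ‖w' t x‖ := by
    intro K δ hδ
    obtain ⟨t, ht, x, h1, h2, h3⟩ := hvunb K δ hδ
    exact ⟨t, ht, x, h1, h2, by rwa [hw'w t ht, hwv t ht]⟩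
  have hmax : IsMaximalSmoothSolution 1 0 w' q 1 := isMaximalSmoothSolution_of_unbounded_near hcl' hunb'
  refine ⟨1, one_pos, 1, one_pos, w', q, hmax, ?_, ?_, ?_⟩
  · rw [hw'0]; exact hLH
  · rw [hw'0]; exact HasRapidSpatialDecay.of_hasCompactSupport hsm hcs
  · -- the Type-I rate survives the two repackagings (`w' = w = v` on `[0, 1)`)
    refine ⟨M₀, ?_⟩
    filter_upwards [Ico_mem_nhdsLT one_pos] with t ht x
    rw [hw'w t ht, hwv t ht]
    exact hvI t ht x

/-- **Crux `DssTruncationBridgeTypeI` of route `DssFarFieldSlaving` (stmt-NavierStokesRegularity-14478),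
PROVED**: failure of Tsai's Type-I (rotated) `λ`-DSS Liouville wall implies the existence, for some
`ν > 0` and `T > 0`, of a Leray–Hopf classical Navier–Stokes solution from a rapidly decaying datum
with finite maximal lifespan `T` which moreover blows up at the Type-I rate.  Composition of the
tree's `exists_typeI_rdss_ancient_of_not_liouville` (the negated wall supplies a nontrivial Type-I
RDSS ancient mild solution) with `rdssProfileTruncation_typeI`. [cite: KochNadirashviliSereginSverak2009, §4] -/
theorem dssTruncationBridgeTypeI_proof :
    Summit.NavierStokesRegularity.NavierStokesRegularity.Theses.DssFarFieldSlaving.DssTruncationBridgeTypeI := by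
  intro hneg
  exact rdssProfileTruncation_typeI (exists_typeI_rdss_ancient_of_not_liouville hneg)

namespace PumpContinuationEulerProximatePump

/-- **Registered stub `stub_dssTruncationBridgeTypeI` of line `SketchIdeator2`** (crux
`EulerProximatePump`, stmt-NavierStokesRegularity-18302; the stub IS item stmt-NavierStokesRegularity-14478
of route `DssFarFieldSlaving`): `dssTruncationBridgeTypeI_proof`. [cite: KochNadirashviliSereginSverak2009, §4] -/
theorem stub_dssTruncationBridgeTypeI : Theses.DssFarFieldSlaving.DssTruncationBridgeTypeI :=
  dssTruncationBridgeTypeI_proof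

end PumpContinuationEulerProximatePump

end Summit.NavierStokesRegularity.NavierStokesRegularity.Theorems

end
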